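import Literature.Computability.Complexity.UmansFPExtField
import Literature.Computability.Complexity.CodeFPFinite
import Literature.Computability.Complexity.CodeFPLists
import Literature.LinearAlgebra.Matrix.ListKernel
import HarnessLib

/-!
# Umans' generator, machine level III: a kernel vector over `K = GF(2^{M+1})` on bitmask codes

Literature / circuit complexity — derandomization. Third machine-level file of the tree's proof of
C. Umans, JCSS 2003, Thm. 6. The interpolation step of Sudan's list decoder (used twice in the
reconstruction: Lemma 13's conversion and Lemma 17's learning step) needs a NONZERO solution of an
underdetermined homogeneous linear system over the base field `K`. The tree's
`Literature.LinearAlgebra.Matrix.ListGauss.kerVec` is that null-space program (Knuth §4.6.2,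
Algorithm N: column elimination) over an abstract field, by structural recursion, with soundness and
completeness proved; `IrreducibilityLLLKernel(FP).lean` realises it modulo a prime. This file is the
twin of those two files for `K = GF2 M` on the bitmask codes of `UmansFPField.lean`:

* the loop form on bitmask rows in the modulus context `c = (W, f, P)`: `kdot`, `elimRowsK`,
  `kerFwdStepK`, `kerFwdRunK`, `backSubK`, **`kerVecK c n rows`**;
* `castVec M = map (GF2.elt M)` commutes with every primitive on REDUCED rows (`cast_kdot`,
  `castRows_elimRowsK`, `castVec_backSubK`), whence **`kerVecK_eq_kerVec`**:
  `(kerVecK (kctx M) n rows).map castVec = kerVec n (castRows rows)` for reduced rows, and the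
  transported `kerVecK_sound` / `kerVecK_complete`;
* unconditional size invariants of both loops (`kinvK_run`, …) and the `CodeFP` certificate
  **`kerVecKC : ((W,f,P), 1ⁿ, rows) ↦ kerVecK (W,f,P) n rows`**.

Everything is proved; no named fact.

## References

* C. Umans, *Pseudo-random generators for all hardnesses*, JCSS 67 (2003), §6 (the reconstruction
  "finds a polynomial `Q` …" by linear algebra over `F_q`) [Umans2003].
* D. E. Knuth, *The Art of Computer Programming*, Vol. 2, 3rd ed., 1998, §4.6.2, Algorithm N
  [KnuthTAOCP2].
* S. Arora, B. Barak, *Computational Complexity: A Modern Approach*, CUP 2009, §1.3 [AroraBarak2009].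
-/

noncomputable section

namespace Literature.Computability.Complexity

open Polynomial Literature.InformationTheory.Coding
open Literature.InformationTheory.Coding.GF2X CodeFP
open Literature.LinearAlgebra.Matrix.ListGauss

namespace UmansFP

/-! ### The programs (modulus context `c = (W, f, P)`) -/

/-- **Dot product** on bitmask vectors: the `xor`-fold of the entrywise products (truncating).
[folklore] -/
def kdot (c : ℕ × ℕ × ℕ) (u v : List ℕ) : ℕ := (List.zipWith (cmul c) u v).foldl (xorW c.1) 0

/-- **One elimination step**: add `(r₀ · piv₀⁻¹) · piv` to every row `r` (characteristic `2`) and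
drop the first column. [cite: KnuthTAOCP2, §4.6.2, Algorithm N] -/
def elimRowsK (c : ℕ × ℕ × ℕ) (piv : List ℕ) (rows : List (List ℕ)) : List (List ℕ) :=
  rows.map fun r => (List.zipWith (fun a b => xorW c.1 a (cmul c (cmul c (r.headD 0) (cinv c (piv.headD 0))) b)) r piv).tail

/-- The forward state: remaining rows, pivots found so far (most recent first), free column met.
[folklore] -/
abbrev KerFwdK := List (List ℕ) × List (List ℕ) × Bool

/-- **One forward step** (one column). [cite: KnuthTAOCP2, §4.6.2, Algorithm N] -/
def kerFwdStepK (c : ℕ × ℕ × ℕ) (st : KerFwdK) : KerFwdK :=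
  if st.2.2 then st else
    match st.1.find? (fun r => decide (r.headD 0 ≠ 0)) with
    | none => (st.1, st.2.1, true)
    | some piv => (elimRowsK c piv st.1, piv :: st.2.1, false)

/-- The forward run over `n` columns. [cite: KnuthTAOCP2, §4.6.2, Algorithm N] -/
def kerFwdRunK (c : ℕ × ℕ × ℕ) (n : ℕ) (st : KerFwdK) : KerFwdK :=
  (List.replicate n ()).foldl (fun st _ => kerFwdStepK c st) st

/-- **One back-substitution**: prepend `piv₀⁻¹ · ⟨piv.tail, v⟩` (characteristic `2`: no sign).
[cite: KnuthTAOCP2, §4.6.2, Algorithm N] -/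
def backSubK (c : ℕ × ℕ × ℕ) (piv v : List ℕ) : List ℕ := cmul c (cinv c (piv.headD 0)) (kdot c piv.tail v) :: v

/-- **A nonzero null vector by column elimination, loop form**, on bitmask rows.
[cite: KnuthTAOCP2, §4.6.2, Algorithm N] -/
def kerVecK (c : ℕ × ℕ × ℕ) (n : ℕ) (rows : List (List ℕ)) : Option (List ℕ) :=
  let st := kerFwdRunK c n (rows, [], false)
  if st.2.2 then some (st.2.1.foldl (fun v piv => backSubK c piv v) (1 :: List.replicate (n - st.2.1.length - 1) 0))
  else none

/-! ### `castVec` commutes with the primitives on reduced data -/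

section Cast

variable (M : ℕ)

/-- Entrywise interpretation of a bitmask vector in `GF2 M`. [folklore] -/
def castVec (v : List ℕ) : List (GF2 M) := v.map (GF2.elt M)

/-- Entrywise interpretation of bitmask rows. [folklore] -/
def castRows (rows : List (List ℕ)) : List (List (GF2 M)) := rows.map (castVec M)

/-- Reduced vectors: all entries `< 2^{M+1}`. [folklore] -/
def KRed (v : List ℕ) : Prop := ∀ x ∈ v, x < 2 ^ (M + 1)

/-- Reduced rows. [folklore] -/
def KRedRows (rows : List (List ℕ)) : Prop := ∀ r ∈ rows, KRed M r

/-- `castVec` on `cons`. [folklore] -/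
@[simp] theorem castVec_cons (x : ℕ) (v : List ℕ) : castVec M (x :: v) = GF2.elt M x :: castVec M v := rfl

/-- `castVec` on `[]`. [folklore] -/
@[simp] theorem castVec_nil : castVec M [] = [] := rfl

/-- `castRows` on `cons`. [folklore] -/
@[simp] theorem castRows_cons (r : List ℕ) (rows : List (List ℕ)) : castRows M (r :: rows) = castVec M r :: castRows M rows := rfl

/-- `castRows` on `[]`. [folklore] -/
@[simp] theorem castRows_nil : castRows M [] = [] := rfl

/-- Length of `castVec`. [folklore] -/
@[simp] theorem length_castVec (v : List ℕ) : (castVec M v).length = v.length := List.length_map _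

/-- `elt 0 = 0`. [folklore] -/
@[simp] theorem elt_zero : GF2.elt M 0 = 0 := by rw [GF2.elt, bitsPoly_zero, map_zero]

/-- `elt 1 = 1`. [folklore] -/
@[simp] theorem elt_one : GF2.elt M 1 = 1 := by rw [GF2.elt, bitsPoly_one, map_one]

/-- `headD` commutes with interpretation. [folklore] -/
theorem headD_castVec (v : List ℕ) : (castVec M v).headD 0 = GF2.elt M (v.headD 0) := by
  cases v <;> simp

/-- `tail` commutes with interpretation. [folklore] -/
theorem tail_castVec (v : List ℕ) : (castVec M v).tail = castVec M v.tail := by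
  cases v <;> simp

/-- `replicate 0` interprets as `replicate 0`. [folklore] -/
theorem castVec_replicate_zero (n : ℕ) : castVec M (List.replicate n 0) = List.replicate n 0 := by
  simp [castVec]

variable {M}

/-- The head of a reduced vector is reduced. [folklore] -/
theorem KRed.headD {v : List ℕ} (h : KRed M v) : v.headD 0 < 2 ^ (M + 1) := by
  cases v with
  | nil => exact Nat.two_pow_pos _
  | cons a v => exact h a List.mem_cons_self

/-- The tail of a reduced vector is reduced. [folklore] -/
theorem KRed.tail {v : List ℕ} (h : KRed M v) : KRed M v.tail := fun x hx => h x (List.mem_of_mem_tail hx)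

/-- On reduced bitmasks, `elt x ≠ 0 ↔ x ≠ 0`. [folklore] -/
theorem elt_ne_zero_iff {x : ℕ} (hx : x < 2 ^ (M + 1)) : GF2.elt M x ≠ 0 ↔ x ≠ 0 :=
  ⟨fun h h0 => h (by rw [h0, elt_zero]), fun h0 => GF2.elt_ne_zero h0 hx⟩

/-- The nonzero-head test commutes with interpretation (reduced vector). [folklore] -/
theorem headTest_castVec {v : List ℕ} (hv : KRed M v) :
    decide ((castVec M v).headD 0 ≠ 0) = decide (v.headD 0 ≠ 0) := by
  rw [headD_castVec, decide_eq_decide]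
  exact elt_ne_zero_iff hv.headD

variable (M)

/-- The `xor`-fold on reduced data is the sum. [folklore] -/
theorem foldl_xorW_spec : ∀ (l : List ℕ) (init : ℕ), init < 2 ^ (M + 1) → (∀ x ∈ l, x < 2 ^ (M + 1)) →
    GF2.elt M (l.foldl (xorW (M + 2)) init) = GF2.elt M init + (l.map (GF2.elt M)).sum ∧
      l.foldl (xorW (M + 2)) init < 2 ^ (M + 1)
  | [], init, hinit, _ => by simp [hinit]
  | x :: l, init, hinit, hl => by
    obtain ⟨hv, hlt⟩ := elt_xorW M (W := M + 2) (by omega) hinit (hl x List.mem_cons_self)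
    obtain ⟨h1, h2⟩ := foldl_xorW_spec l _ hlt fun y hy => hl y (List.mem_cons_of_mem x hy)
    refine ⟨?_, h2⟩
    rw [List.foldl_cons, h1, hv, List.map_cons, List.sum_cons, add_assoc]

/-- A `zipWith` of reduced vectors by a brick that interprets as `g` interprets as the `zipWith` by
`g`, and stays reduced. [folklore] -/
theorem castVec_zipWith {f : ℕ → ℕ → ℕ} {g : GF2 M → GF2 M → GF2 M}
    (hfg : ∀ a b, a < 2 ^ (M + 1) → b < 2 ^ (M + 1) → GF2.elt M (f a b) = g (GF2.elt M a) (GF2.elt M b) ∧ f a b < 2 ^ (M + 1)) :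
    ∀ {u v : List ℕ}, KRed M u → KRed M v →
      castVec M (List.zipWith f u v) = List.zipWith g (castVec M u) (castVec M v) ∧ KRed M (List.zipWith f u v)
  | [], _, _, _ => by simp [KRed]
  | _ :: _, [], _, _ => by simp [KRed]
  | a :: u, b :: v, hu, hv => by
    obtain ⟨h1, h2⟩ := castVec_zipWith hfg (fun x hx => hu x (List.mem_cons_of_mem a hx)) (fun x hx => hv x (List.mem_cons_of_mem b hx))
    obtain ⟨hab, hablt⟩ := hfg a b (hu a List.mem_cons_self) (hv b List.mem_cons_self)
    refine ⟨by rw [List.zipWith_cons_cons, castVec_cons, h1, hab, castVec_cons, castVec_cons, List.zipWith_cons_cons], ?_⟩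
    intro x hx
    rw [List.zipWith_cons_cons, List.mem_cons] at hx
    rcases hx with rfl | hx
    · exact hablt
    · exact h2 x hx

/-- **The dot product commutes with interpretation** (reduced vectors), and is reduced.
[folklore] -/
theorem cast_kdot {u v : List ℕ} (hu : KRed M u) (hv : KRed M v) :
    GF2.elt M (kdot (kctx M) u v) = dot (castVec M u) (castVec M v) ∧ kdot (kctx M) u v < 2 ^ (M + 1) := by
  obtain ⟨h1, h2⟩ := castVec_zipWith M (f := cmul (kctx M)) (g := (· * ·))
    (fun a b ha hb => kmul_spec M ha hb) hu hv
  obtain ⟨h3, h4⟩ := foldl_xorW_spec M _ 0 (Nat.two_pow_pos _) h2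
  refine ⟨?_, h4⟩
  rw [kdot, show (kctx M).1 = M + 2 from rfl, h3, elt_zero, zero_add, dot, ← h1]
  rfl

/-- **Elimination commutes with interpretation** (reduced pivot with nonzero head, reduced rows),
and outputs reduced rows. [folklore] -/
theorem castRows_elimRowsK {piv : List ℕ} (hpiv : KRed M piv) (hpiv0 : GF2.elt M (piv.headD 0) ≠ 0)
    {rows : List (List ℕ)} (hrows : KRedRows M rows) :
    castRows M (elimRowsK (kctx M) piv rows) = elimRows (castVec M piv) (castRows M rows) ∧
      KRedRows M (elimRowsK (kctx M) piv rows) := by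
  obtain ⟨hinv, hinvlt⟩ := kinv_spec M hpiv.headD hpiv0
  have hrow : ∀ r, KRed M r →
      castVec M ((List.zipWith (fun a b => xorW (kctx M).1 a (cmul (kctx M) (cmul (kctx M) (r.headD 0) (cinv (kctx M) (piv.headD 0))) b)) r piv).tail) =
        (List.zipWith (fun a b => a - (castVec M r).headD 0 * ((castVec M piv).headD 0)⁻¹ * b) (castVec M r) (castVec M piv)).tail ∧
      KRed M ((List.zipWith (fun a b => xorW (kctx M).1 a (cmul (kctx M) (cmul (kctx M) (r.headD 0) (cinv (kctx M) (piv.headD 0))) b)) r piv).tail) := by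
    intro r hr
    obtain ⟨hs, hslt⟩ := kmul_spec M hr.headD hinvlt
    have key := castVec_zipWith M
      (f := fun a b => xorW (kctx M).1 a (cmul (kctx M) (cmul (kctx M) (r.headD 0) (cinv (kctx M) (piv.headD 0))) b))
      (g := fun a b => a - GF2.elt M (r.headD 0) * (GF2.elt M (piv.headD 0))⁻¹ * b) (fun a b ha hb => by
        obtain ⟨hm, hmlt⟩ := kmul_spec M hslt hb
        obtain ⟨hx, hxlt⟩ := elt_xorW M (W := M + 2) (by omega) ha hmlt
        refine ⟨?_, hxlt⟩
        show GF2.elt M (xorW (M + 2) a (kmul M (kmul M (r.headD 0) (kinv M (piv.headD 0))) b)) = _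
        rw [hx, hm, hs, hinv, CharTwo.sub_eq_add]) hr hpiv
    rw [← tail_castVec, key.1, headD_castVec, headD_castVec]
    exact ⟨rfl, key.2.tail⟩
  refine ⟨?_, fun r hr => ?_⟩
  · unfold elimRowsK elimRows castRows
    rw [List.map_map, List.map_map]
    refine List.map_congr_left fun r hr => ?_
    simp only [Function.comp_apply]
    exact (hrow r (hrows r hr)).1
  · obtain ⟨r', hr', rfl⟩ := List.mem_map.1 hr
    exact (hrow r' (hrows r' hr')).2

/-- **Back-substitution commutes with interpretation** (reduced data), and outputs a reduced vector.
[folklore] -/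
theorem castVec_backSubK {piv : List ℕ} (hpiv : KRed M piv) (hpiv0 : GF2.elt M (piv.headD 0) ≠ 0)
    {v : List ℕ} (hv : KRed M v) :
    castVec M (backSubK (kctx M) piv v) =
      (-(((castVec M piv).headD 0)⁻¹ * dot (castVec M piv).tail (castVec M v))) :: castVec M v ∧
      KRed M (backSubK (kctx M) piv v) := by
  haveI : CharP (GF2 M) 2 := GF2.charP M
  obtain ⟨hinv, hinvlt⟩ := kinv_spec M hpiv.headD hpiv0
  obtain ⟨hd, hdlt⟩ := cast_kdot M hpiv.tail hv
  obtain ⟨hm, hmlt⟩ := kmul_spec M hinvlt hdlt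
  refine ⟨?_, fun x hx => ?_⟩
  · rw [backSubK, castVec_cons, CharTwo.neg_eq, headD_castVec, tail_castVec]
    show GF2.elt M (kmul M (kinv M (piv.headD 0)) (kdot (kctx M) piv.tail v)) :: castVec M v = _
    rw [hm, hinv, hd]
  · rcases List.mem_cons.1 hx with rfl | hx
    · exact hmlt
    · exact hv x hx

end Cast

/-! ### The loop computes `kerVec` -/

section Equiv

variable {c : ℕ × ℕ × ℕ}

/-- Peeling the first step of a run. [folklore] -/
theorem kerFwdRunK_succ (st : KerFwdK) (m : ℕ) : kerFwdRunK c (m + 1) st = kerFwdRunK c m (kerFwdStepK c st) := by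
  simp [kerFwdRunK, List.replicate_succ]

/-- Idle forward runs. [folklore] -/
theorem kerFwdRunK_true (n : ℕ) (rs Q : List (List ℕ)) : kerFwdRunK c n (rs, Q, true) = (rs, Q, true) := by
  induction n with
  | zero => rfl
  | succ m ih => rw [kerFwdRunK_succ]; unfold kerFwdStepK; simpa using ih

/-- The forward run does not read the pivot list. [folklore] -/
theorem kerFwdRunK_pivots (rows : List (List ℕ)) (P : List (List ℕ)) : ∀ n : ℕ,
    kerFwdRunK c n (rows, P, false) =
      ((kerFwdRunK c n (rows, [], false)).1, (kerFwdRunK c n (rows, [], false)).2.1 ++ P, (kerFwdRunK c n (rows, [], false)).2.2)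
  | 0 => by simp [kerFwdRunK]
  | n + 1 => by
    rw [kerFwdRunK_succ, kerFwdRunK_succ]
    unfold kerFwdStepK
    simp only [Bool.false_eq_true, ↓reduceIte]
    cases hfind : rows.find? (fun r => decide (r.headD 0 ≠ 0)) with
    | none =>
      simp only []
      rw [kerFwdRunK_true, kerFwdRunK_true]
      simp
    | some piv =>
      simp only []
      rw [kerFwdRunK_pivots (elimRowsK c piv rows) (piv :: P) n, kerFwdRunK_pivots (elimRowsK c piv rows) [piv] n]
      simp

/-- **The recursion of `kerVec` holds for the loop.** [cite: KnuthTAOCP2, §4.6.2, Algorithm N] -/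
theorem kerVecK_succ (n : ℕ) (rows : List (List ℕ)) :
    kerVecK c (n + 1) rows =
      match rows.find? (fun r => decide (r.headD 0 ≠ 0)) with
      | none => some (1 :: List.replicate n 0)
      | some piv => (kerVecK c n (elimRowsK c piv rows)).map (backSubK c piv) := by
  unfold kerVecK
  simp only []
  rw [kerFwdRunK_succ]
  unfold kerFwdStepK
  simp only [Bool.false_eq_true, ↓reduceIte]
  cases hfind : rows.find? (fun r => decide (r.headD 0 ≠ 0)) with
  | none =>
    simp only []
    rw [kerFwdRunK_true]
    simp
  | some piv =>
    simp only []
    rw [kerFwdRunK_pivots]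
    simp only [List.foldl_append, List.foldl_cons, List.foldl_nil, List.length_append, List.length_singleton,
      Nat.add_sub_add_right]
    split_ifs with h <;> rfl

/-- `kerVecK` on `0` columns finds nothing. [folklore] -/
@[simp] theorem kerVecK_zero (rows : List (List ℕ)) : kerVecK c 0 rows = none := by
  simp [kerVecK, kerFwdRunK]

variable {M : ℕ}

open Classical in
/-- **The loop computes `kerVec` over `GF2 M`** on reduced rows, and returns reduced vectors.
[cite: KnuthTAOCP2, §4.6.2, Algorithm N] -/
theorem kerVecK_eq_kerVec : ∀ (n : ℕ) (rows : List (List ℕ)), KRedRows M rows →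
    (kerVecK (kctx M) n rows).map (castVec M) = kerVec n (castRows M rows) ∧
      ∀ v, kerVecK (kctx M) n rows = some v → KRed M v
  | 0, rows, _ => by simp
  | n + 1, rows, hrows => by
    rw [kerVecK_succ, kerVec_succ]
    have hfind : (castRows M rows).find? (fun r => decide (r.headD 0 ≠ 0)) =
        (rows.find? (fun r => decide (r.headD 0 ≠ 0))).map (castVec M) := by
      rw [castRows, List.find?_map]
      congr 1
      refine List.find?_congr fun r hr => ?_
      simp only [Function.comp_apply]
      exact headTest_castVec (hrows r hr)
    rw [hfind]
    cases h : rows.find? (fun r => decide (r.headD 0 ≠ 0)) with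
    | none =>
      simp only [Option.map_some, Option.map_none, castVec_cons, elt_one, castVec_replicate_zero]
      refine ⟨trivial, fun v hv => ?_⟩
      rw [Option.some.injEq] at hv
      subst hv
      intro x hx
      rcases List.mem_cons.1 hx with rfl | hx
      · exact Nat.one_lt_two_pow (by omega)
      · rw [List.eq_of_mem_replicate hx]; exact Nat.two_pow_pos _
    | some piv =>
      have hmem : piv ∈ rows := List.mem_of_find?_eq_some h
      have hpiv : KRed M piv := hrows piv hmem
      have hpiv0' : piv.headD 0 ≠ 0 := by
        have := List.find?_some h
        simpa using this
      have hpiv0 : GF2.elt M (piv.headD 0) ≠ 0 := (elt_ne_zero_iff hpiv.headD).2 hpiv0'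
      obtain ⟨hcast, hred⟩ := castRows_elimRowsK M hpiv hpiv0 hrows
      obtain ⟨ih1, ih2⟩ := kerVecK_eq_kerVec n (elimRowsK (kctx M) piv rows) hred
      simp only [Option.map_some]
      rw [← hcast, ← ih1]
      cases hk : kerVecK (kctx M) n (elimRowsK (kctx M) piv rows) with
      | none => simp
      | some v =>
        obtain ⟨hb1, hb2⟩ := castVec_backSubK M hpiv hpiv0 (ih2 v hk)
        simp only [Option.map_some, Option.some.injEq, forall_eq']
        exact ⟨hb1, hb2⟩

open Classical in
/-- **Soundness**: a vector returned by `kerVecK` on reduced rows of length `n` has length `n`, is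
reduced, nonzero, and orthogonal to every row. [cite: KnuthTAOCP2, §4.6.2, Algorithm N] -/
theorem kerVecK_sound {n : ℕ} {rows : List (List ℕ)} (hrows : ∀ r ∈ rows, r.length = n) (hred : KRedRows M rows)
    {v : List ℕ} (h : kerVecK (kctx M) n rows = some v) :
    v.length = n ∧ KRed M v ∧ (∃ x ∈ v, GF2.elt M x ≠ 0) ∧ ∀ r ∈ rows, dot (castVec M r) (castVec M v) = 0 := by
  obtain ⟨heq, hredv⟩ := kerVecK_eq_kerVec n rows hred
  have hK : kerVec n (castRows M rows) = some (castVec M v) := by rw [← heq, h, Option.map_some]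
  have hrows' : ∀ r ∈ castRows M rows, r.length = n := by
    intro r hr
    obtain ⟨r', hr', rfl⟩ := List.mem_map.1 hr
    rw [length_castVec, hrows r' hr']
  refine ⟨?_, hredv v h, ?_, fun r hr => ?_⟩
  · simpa using length_of_kerVec_eq_some _ _ _ hK
  · obtain ⟨x, hx, hx0⟩ := exists_ne_zero_of_kerVec_eq_some _ _ _ hK
    obtain ⟨y, hy, rfl⟩ := List.mem_map.1 hx
    exact ⟨y, hy, hx0⟩
  · exact dot_eq_zero_of_kerVec_eq_some n _ hrows' _ hK _ (List.mem_map.2 ⟨r, hr, rfl⟩)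

open Classical in
/-- **Completeness**: if a nonzero vector of length `n` orthogonal to all (reduced, length-`n`)
rows exists, `kerVecK` returns a vector. [cite: KnuthTAOCP2, §4.6.2, Algorithm N] -/
theorem kerVecK_complete {n : ℕ} {rows : List (List ℕ)} (hrows : ∀ r ∈ rows, r.length = n) (hred : KRedRows M rows)
    (u : List (GF2 M)) (hu : u.length = n) (hne : ∃ x ∈ u, x ≠ 0) (horth : ∀ r ∈ rows, dot (castVec M r) u = 0) :
    (kerVecK (kctx M) n rows).isSome = true := by
  have hrows' : ∀ r ∈ castRows M rows, r.length = n := by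
    intro r hr
    obtain ⟨r', hr', rfl⟩ := List.mem_map.1 hr
    rw [length_castVec, hrows r' hr']
  have h := isSome_kerVec n (castRows M rows) hrows' u hu hne (fun r hr => by
    obtain ⟨r', hr', rfl⟩ := List.mem_map.1 hr
    exact horth r' hr')
  rw [← (kerVecK_eq_kerVec n rows hred).1] at h
  simpa using h

end Equiv

/-! ### Unconditional sizes -/

section Bounds

variable (c : ℕ × ℕ × ℕ)

/-- Entries at most `2ᵂ`. [folklore] -/
def KBnd (W : ℕ) (r : List ℕ) : Prop := ∀ x ∈ r, x ≤ 2 ^ W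

/-- Elimination outputs rows with entries `< 2ᵂ` (brick outputs), as many rows, none wider than the
pivot. [folklore] -/
theorem elimRowsK_bound (piv : List ℕ) (rows : List (List ℕ)) :
    (∀ r ∈ elimRowsK c piv rows, KBnd c.1 r) ∧ (elimRowsK c piv rows).length = rows.length ∧
      ∀ r ∈ elimRowsK c piv rows, r.length ≤ piv.length := by
  refine ⟨fun r hr x hx => ?_, List.length_map _, fun r hr => ?_⟩
  · obtain ⟨r', -, rfl⟩ := List.mem_map.1 hr
    obtain ⟨_, -, _, -, rfl⟩ := exists_of_mem_zipWith (List.mem_of_mem_tail hx)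
    exact (xorW_lt _ _ _).le
  · obtain ⟨r', -, rfl⟩ := List.mem_map.1 hr
    rw [List.length_tail, List.length_zipWith]
    omega

/-- Back-substitution keeps entries at most `2ᵂ`. [folklore] -/
theorem backSubK_bound (piv : List ℕ) {v : List ℕ} (hv : KBnd c.1 v) : KBnd c.1 (backSubK c piv v) := by
  intro x hx
  rcases List.mem_cons.1 hx with rfl | hx
  · exact (GF2X.mulMod_lt _ _ _ _ _ _).le
  · exact hv x hx

/-- The widest row. [folklore] -/
def maxLen (rows : List (List ℕ)) : ℕ := (rows.map List.length).foldr max 0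

/-- Every row is at most as wide as the widest. [folklore] -/
theorem length_le_maxLen {rows : List (List ℕ)} {r : List ℕ} (h : r ∈ rows) : r.length ≤ maxLen rows := by
  induction rows with
  | nil => simp at h
  | cons a rows ih =>
    simp only [maxLen, List.map_cons, List.foldr_cons]
    rcases List.mem_cons.1 h with rfl | h
    · exact le_max_left _ _
    · exact (ih h).trans (le_max_right _ _)

/-- The widest row fits in the code. [folklore] -/
theorem maxLen_le_code (rows : List (List ℕ)) : maxLen rows ≤ (rawE (rawE natE) rows).length := by
  induction rows with
  | nil => simp [maxLen]
  | cons a rows ih =>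
    simp only [maxLen, List.map_cons, List.foldr_cons, rawE_cons, length_boolPair]
    refine max_le ?_ ?_
    · have := length_le_length_rawE natE a; omega
    · change maxLen rows ≤ _; omega

/-- A row of a forward state is an input row or a bounded row not wider than the input.
[folklore] -/
def KRow (W : ℕ) (rows₀ : List (List ℕ)) (Wd : ℕ) (r : List ℕ) : Prop := r ∈ rows₀ ∨ (KBnd W r ∧ r.length ≤ Wd)

/-- The size invariant of the forward loop after `j` steps. [folklore] -/
def KInv (W : ℕ) (rows₀ : List (List ℕ)) (Wd j : ℕ) (st : KerFwdK) : Prop :=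
  (∀ r ∈ st.1, KRow W rows₀ Wd r) ∧ (∀ r ∈ st.2.1, KRow W rows₀ Wd r) ∧ st.1.length ≤ rows₀.length ∧ st.2.1.length ≤ j ∧
    ∀ r ∈ st.1, r.length ≤ Wd

/-- **One forward step keeps the invariant.** [folklore] -/
theorem kinvK_step {rows₀ : List (List ℕ)} {Wd j : ℕ} {st : KerFwdK} (h : KInv c.1 rows₀ Wd j st) :
    KInv c.1 rows₀ Wd (j + 1) (kerFwdStepK c st) := by
  obtain ⟨rows, piv, found⟩ := st
  obtain ⟨h1, h2, h3, h4, h5⟩ := h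
  dsimp only at h1 h2 h3 h4 h5
  unfold kerFwdStepK
  cases found
  · simp only [Bool.false_eq_true, ↓reduceIte]
    cases hf : rows.find? (fun r => decide (r.headD 0 ≠ 0)) with
    | none => exact ⟨h1, h2, h3, h4.trans (Nat.le_succ _), h5⟩
    | some pv =>
      have hpv : pv ∈ rows := List.mem_of_find?_eq_some hf
      have hpvW : pv.length ≤ Wd := h5 pv hpv
      obtain ⟨e1, e2, e3⟩ := elimRowsK_bound c pv rows
      refine ⟨fun r hr => Or.inr ⟨e1 r hr, (e3 r hr).trans hpvW⟩, fun r hr => ?_, by rw [e2]; exact h3,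
        by rw [List.length_cons]; omega, fun r hr => (e3 r hr).trans hpvW⟩
      rcases List.mem_cons.1 hr with rfl | hr
      · exact h1 _ hpv
      · exact h2 r hr
  · simp only [↓reduceIte]
    exact ⟨h1, h2, h3, h4.trans (Nat.le_succ _), h5⟩

/-- The run from `(rows₀, [], false)`. [folklore] -/
theorem kinvK_run (rows₀ : List (List ℕ)) (u : List Unit) :
    KInv c.1 rows₀ (maxLen rows₀) u.length (u.foldl (fun st _ => kerFwdStepK c st) (rows₀, [], false)) := by
  induction u using List.reverseRecOn with
  | nil =>
    exact ⟨fun r hr => Or.inl hr, fun r hr => by simp at hr, le_rfl, le_rfl, fun r hr => length_le_maxLen hr⟩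
  | append_singleton u x ih =>
    rw [List.foldl_append, List.foldl_cons, List.foldl_nil, List.length_append, List.length_singleton]
    exact kinvK_step c ih

/-- The code of a list of rows each coding in `≤ E` symbols. [folklore] -/
theorem length_rawE_rawE_le {rows : List (List ℕ)} {E : ℕ} (h : ∀ r ∈ rows, (rawE natE r).length ≤ E) :
    (rawE (rawE natE) rows).length ≤ rows.length * (2 * E + 2) := by
  rw [length_rawE]
  have : ∀ x ∈ rows.map (fun r => 2 * (rawE natE r).length + 2), x ≤ 2 * E + 2 := fun x hx => by
    obtain ⟨r, hr, rfl⟩ := List.mem_map.1 hx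
    have := h r hr; omega
  simpa using List.sum_le_card_nsmul _ _ this

/-- The code of a bounded vector. [folklore] -/
theorem length_rawE_of_kbnd {W : ℕ} {r : List ℕ} (h : KBnd W r) : (rawE natE r).length ≤ r.length * (2 * W + 4) := by
  induction r with
  | nil => simp
  | cons a r ih =>
    rw [rawE_cons, length_boolPair, List.length_cons, add_mul, one_mul, length_natE]
    have ha : Nat.size a ≤ W + 1 := (Nat.size_le_size (h a List.mem_cons_self)).trans (by rw [Nat.size_pow])
    have hl := ih fun x hx => h x (List.mem_cons_of_mem a hx)
    omega

/-- The code of a row of a forward state. [folklore] -/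
theorem length_code_krowK_le {W Lc : ℕ} {rows₀ : List (List ℕ)} {r : List ℕ} (h : KRow W rows₀ (maxLen rows₀) r)
    (hrows : (rawE (rawE natE) rows₀).length ≤ Lc) (hW : W ≤ Lc) : (rawE natE r).length ≤ Lc * (2 * Lc + 4) + Lc := by
  rcases h with h | ⟨hb, hlen⟩
  · have := length_item_le_length_rawE (rawE natE) h; omega
  · have hWd : maxLen rows₀ ≤ Lc := (maxLen_le_code rows₀).trans hrows
    have h1 := length_rawE_of_kbnd hb
    have h2 : r.length * (2 * W + 4) ≤ Lc * (2 * Lc + 4) := Nat.mul_le_mul (hlen.trans hWd) (by omega)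
    omega

/-- Along the `xor`-fold the accumulator is at most `2ᵂ`. [folklore] -/
theorem foldl_xorW_le (W : ℕ) : ∀ (l : List ℕ) (init : ℕ), init ≤ 2 ^ W → l.foldl (xorW W) init ≤ 2 ^ W
  | [], _, h => h
  | _ :: l, _, _ => foldl_xorW_le W l _ (xorW_lt _ _ _).le

end Bounds

/-! ### `CodeFP` certificates -/

section Machine

/-- The code of bitmask vectors. -/
local notation "L" => rawE natE

/-- **The dot product on codes**: `(c, u, v) ↦ kdot c u v`. [cite: AroraBarak2009, §1.3] -/
theorem kdotC : CodeFP (pairE kctxE (pairE L L)) natE (fun t => kdot t.1 t.2.1 t.2.2) := by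
  have hz := zipWith (σ := ℕ × ℕ × ℕ) (eσ := kctxE) (eα := natE) (eβ := natE) (eγ := natE)
    (g := fun t => cmul t.1 t.2.1 t.2.2) (kmulFP.congr fun _ => rfl)
  have hf := foldl (σ := ℕ × ℕ × ℕ) (α := ℕ) (β := ℕ) (eσ := kctxE) (eα := natE) (eβ := natE)
    (step := fun c a acc => xorW c.1 acc a) (init := fun _ => 0)
    ((xorFP.comp ((fst _ _).fst'.pair ((snd _ _).snd'.pair (snd _ _).fst'))) :) (const _ 0) (X + 1)
    (fun c l₁ l₂ => by
      obtain ⟨W, f, P⟩ := c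
      dsimp only
      have hle := foldl_xorW_le W l₁ 0 (Nat.zero_le _)
      have hsz : Nat.size (l₁.foldl (xorW W) 0) ≤ W + 1 := (Nat.size_le_size hle).trans (by rw [Nat.size_pow])
      simp only [pairE_apply, length_boolPair, length_unE, eval_add, eval_X, eval_one, length_natE]
      change Nat.size (l₁.foldl (xorW W) 0) ≤ _
      omega)
  exact ((hf.comp ((fst _ _).pair hz)).congr fun t => rfl)

/-- **Elimination on codes**: `(c, piv, rows) ↦ elimRowsK c piv rows`. [cite: KnuthTAOCP2, §4.6.2, Algorithm N] -/
theorem elimRowsKC : CodeFP (pairE kctxE (pairE L (rawE L))) (rawE L) (fun t => elimRowsK t.1 t.2.1 t.2.2) := by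
  -- entry zip in the context `(c, s)`: `(a, b) ↦ a ⊕ s·b`
  have hg : CodeFP (pairE (pairE kctxE natE) (pairE natE natE)) natE (fun t => xorW t.1.1.1 t.2.1 (cmul t.1.1 t.1.2 t.2.2)) :=
    (xorFP.comp ((fst _ _).fst'.fst'.pair ((snd _ _).fst'.pair (kmulFP.comp ((fst _ _).fst'.pair ((fst _ _).snd'.pair
      (snd _ _).snd'))))) :)
  have hz := zipWith (σ := (ℕ × ℕ × ℕ) × ℕ) (eσ := pairE kctxE natE) (eα := natE) (eβ := natE) (eγ := natE)
    (g := fun t => xorW t.1.1.1 t.2.1 (cmul t.1.1 t.1.2 t.2.2)) hg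
  -- the row map: context `(c, inv, piv)`, item `r`; scalar `s = (r₀ · inv)`
  have hrow : CodeFP (pairE (pairE kctxE (pairE natE L)) L) L
      (fun t => (List.zipWith (fun a b => xorW t.1.1.1 a (cmul t.1.1 (cmul t.1.1 (t.2.headD 0) t.1.2.1) b)) t.2 t.1.2.2).tail) := by
    have hc : CodeFP (pairE (pairE kctxE (pairE natE L)) L) kctxE (fun t => t.1.1) := (fst _ _).fst'
    have hs : CodeFP (pairE (pairE kctxE (pairE natE L)) L) natE (fun t => cmul t.1.1 (t.2.headD 0) t.1.2.1) :=
      (kmulFP.comp (hc.pair (((rawHeadOr natE).comp ((const _ (0 : ℕ)).pair (snd _ _))).pair (fst _ _).snd'.fst')) :)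
    exact ((rawTail natE).comp (hz.comp ((hc.pair hs).pair ((snd _ _).pair (fst _ _).snd'.snd'))) :)
  have hm := map (σ := (ℕ × ℕ × ℕ) × ℕ × List ℕ) (eσ := pairE kctxE (pairE natE L)) (eα := L) (eβ := L)
    (g := fun t => (List.zipWith (fun a b => xorW t.1.1.1 a (cmul t.1.1 (cmul t.1.1 (t.2.headD 0) t.1.2.1) b)) t.2 t.1.2.2).tail) hrow
  have hctx : CodeFP (pairE kctxE (pairE L (rawE L))) (pairE kctxE (pairE natE L))
      (fun t => (t.1, cinv t.1 (t.2.1.headD 0), t.2.1)) :=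
    ((fst _ _).pair ((kinvFP.comp ((fst _ _).pair ((rawHeadOr natE).comp ((const _ (0 : ℕ)).pair (snd _ _).fst')))).pair
      (snd _ _).fst') :)
  exact ((hm.comp (hctx.pair (snd _ _).snd')).congr fun _ => rfl)

/-- The encoder of the forward state. -/
local notation "KF" => pairE (rawE (rawE natE)) (pairE (rawE (rawE natE)) bitE)

/-- **One forward step on codes**: `(c, st) ↦ kerFwdStepK c st`. [cite: KnuthTAOCP2, §4.6.2, Algorithm N] -/
theorem kerFwdStepKC : CodeFP (pairE kctxE KF) KF (fun t => kerFwdStepK t.1 t.2) := by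
  have hc : CodeFP (pairE kctxE KF) kctxE (fun t => t.1) := (fst _ _ :)
  have hrows : CodeFP (pairE kctxE KF) (rawE L) (fun t => t.2.1) := ((snd _ _).fst' :)
  have hpiv : CodeFP (pairE kctxE KF) (rawE L) (fun t => t.2.2.1) := ((snd _ _).snd'.fst' :)
  have hfound : CodeFP (pairE kctxE KF) bitE (fun t => t.2.2.2) := ((snd _ _).snd'.snd' :)
  have hpred : CodeFP (pairE kctxE L) bitE (fun t => decide (t.2.headD 0 ≠ 0)) :=
    ((natEq.comp (((rawHeadOr natE).comp ((const _ (0 : ℕ)).pair (snd _ _))).pair (const _ (0 : ℕ)))).not.congr fun t => by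
      simp)
  have hfind : CodeFP (pairE kctxE KF) (optE L) (fun t => t.2.1.find? fun r => decide (r.headD 0 ≠ 0)) :=
    ((rawFind? (σ := ℕ × ℕ × ℕ) (eσ := kctxE) (eα := L) hpred).comp (hc.pair hrows) :)
  have hnone : CodeFP (pairE kctxE KF) KF (fun t => (t.2.1, t.2.2.1, true)) := (hrows.pair (hpiv.pair (const _ true)) :)
  have hsome : CodeFP (pairE (pairE kctxE KF) L) KF (fun t => (elimRowsK t.1.1 t.2 t.1.2.1, t.2 :: t.1.2.2.1, false)) :=
    ((elimRowsKC.comp ((fst _ _).fst'.pair ((snd _ _).pair (fst _ _).snd'.fst'))).pair (((rawCons L).comp ((snd _ _).pair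
      (fst _ _).snd'.snd'.fst')).pair (const _ false)) :)
  have hcases := optCases (σ := (ℕ × ℕ × ℕ) × KerFwdK) (eσ := pairE kctxE KF) (eα := L) (eδ := KF)
    (k := fun s o => match o with | none => (s.2.1, s.2.2.1, true) | some piv => (elimRowsK s.1 piv s.2.1, piv :: s.2.2.1, false))
    hnone hsome (fun _ => rfl) (fun _ _ => rfl)
  have hact : CodeFP (pairE kctxE KF) KF (fun t => match t.2.1.find? fun r => decide (r.headD 0 ≠ 0) with
      | none => (t.2.1, t.2.2.1, true) | some piv => (elimRowsK t.1 piv t.2.1, piv :: t.2.2.1, false)) :=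
    ((hcases.comp ((CodeFP.id _).pair hfind)).congr fun _ => rfl)
  refine ((hfound.ite (snd _ _) hact).congr fun t => ?_)
  obtain ⟨c, rows, piv, found⟩ := t
  unfold kerFwdStepK
  cases found <;> rfl

/-- **One back-substitution on codes**: `(c, piv, v) ↦ backSubK c piv v`. [cite: KnuthTAOCP2, §4.6.2, Algorithm N] -/
theorem backSubKC : CodeFP (pairE kctxE (pairE L L)) L (fun t => backSubK t.1 t.2.1 t.2.2) := by
  have hc : CodeFP (pairE kctxE (pairE L L)) kctxE (fun t => t.1) := (fst _ _ :)
  have hpiv : CodeFP (pairE kctxE (pairE L L)) L (fun t => t.2.1) := ((snd _ _).fst' :)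
  have hv : CodeFP (pairE kctxE (pairE L L)) L (fun t => t.2.2) := ((snd _ _).snd' :)
  have hinv : CodeFP (pairE kctxE (pairE L L)) natE (fun t => cinv t.1 (t.2.1.headD 0)) :=
    (kinvFP.comp (hc.pair ((rawHeadOr natE).comp ((const _ (0 : ℕ)).pair hpiv))) :)
  have hdot : CodeFP (pairE kctxE (pairE L L)) natE (fun t => kdot t.1 t.2.1.tail t.2.2) :=
    (kdotC.comp (hc.pair (((rawTail natE).comp hpiv).pair hv)) :)
  exact (((rawCons natE).comp ((kmulFP.comp (hc.pair (hinv.pair hdot))).pair hv)).congr fun _ => rfl)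

/-- **`kerVecK c n rows` on codes** (`n` unary): the forward fold over `n` ticks, then — if a free
column was met — the backward fold over the recorded pivots from the unit vector.
[cite: KnuthTAOCP2, §4.6.2, Algorithm N] [cite: AroraBarak2009, §1.3] -/
theorem kerVecKC : CodeFP (pairE kctxE (pairE unE (rawE L))) (optE L) (fun t => kerVecK t.1 t.2.1 t.2.2) := by
  -- forward
  have hstep : CodeFP (pairE (pairE kctxE (pairE unE (rawE L))) (pairE unitE KF)) KF (fun t => kerFwdStepK t.1.1 t.2.2) :=
    (kerFwdStepKC.comp ((fst _ _).fst'.pair (snd _ _).snd') :)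
  have hinit : CodeFP (pairE kctxE (pairE unE (rawE L))) KF (fun s => (s.2.2, ([] : List (List ℕ)), false)) :=
    ((snd _ _).snd'.pair ((const _ ([] : List (List ℕ))).pair (const _ false)) :)
  have hfwd := foldl (σ := (ℕ × ℕ × ℕ) × (ℕ × List (List ℕ))) (α := Unit) (β := KerFwdK)
    (eσ := pairE kctxE (pairE unE (rawE L))) (eα := unitE)
    (eβ := KF) (step := fun s _ st => kerFwdStepK s.1 st) (init := fun s => (s.2.2, [], false)) hstep hinit
    (60 * (X + 1) ^ 3) (fun s l₁ l₂ => by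
      obtain ⟨c, n, rows⟩ := s
      change (pairE (rawE (rawE natE)) (pairE (rawE (rawE natE)) bitE) (l₁.foldl (fun st (_ : Unit) => kerFwdStepK c st) (rows, [], false))).length ≤ _
      set Lc := (pairE (pairE kctxE (pairE unE (rawE L))) (rawE unitE) ((c, n, rows), l₁ ++ l₂)).length with hLc
      obtain ⟨h1, h2, h3, h4, -⟩ := kinvK_run c rows l₁
      set st := l₁.foldl (fun st (_ : Unit) => kerFwdStepK c st) (rows, [], false)
      obtain ⟨W, f, P⟩ := c
      have hLr : (rawE (rawE natE) rows).length ≤ Lc := by rw [hLc]; simp only [pairE_apply, length_boolPair]; omega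
      have hLW : W ≤ Lc := by rw [hLc]; simp only [pairE_apply, length_boolPair, length_unE]; omega
      have hLu : l₁.length ≤ Lc := by
        rw [hLc]; simp only [pairE_apply, length_boolPair]
        have := length_le_length_rawE unitE (l₁ ++ l₂); rw [List.length_append] at this; omega
      have hLn : rows.length ≤ Lc := (length_le_length_rawE (rawE natE) rows).trans hLr
      have e1 := length_rawE_rawE_le fun r hr => length_code_krowK_le (h1 r hr) hLr hLW
      have e2 := length_rawE_rawE_le fun r hr => length_code_krowK_le (h2 r hr) hLr hLW
      have f1 : st.1.length * (2 * (Lc * (2 * Lc + 4) + Lc) + 2) ≤ Lc * (2 * (Lc * (2 * Lc + 4) + Lc) + 2) :=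
        Nat.mul_le_mul_right _ (h3.trans hLn)
      have f2 : st.2.1.length * (2 * (Lc * (2 * Lc + 4) + Lc) + 2) ≤ Lc * (2 * (Lc * (2 * Lc + 4) + Lc) + 2) :=
        Nat.mul_le_mul_right _ (h4.trans hLu)
      have hb : (bitE st.2.2).length = 1 := rfl
      simp only [pairE_apply, length_boolPair, eval_mul, eval_pow, eval_add, eval_X, eval_ofNat, eval_one, hb]
      nlinarith)
  have hst : CodeFP (pairE kctxE (pairE unE (rawE L))) KF (fun t => kerFwdRunK t.1 t.2.1 (t.2.2, [], false)) :=
    ((hfwd.comp ((CodeFP.id _).pair (replicateUnit.comp (snd _ _).fst'))).congr fun _ => rfl)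
  -- backward: fold over the pivots with context `σ = (c, (n, pivots))`
  have hbstep : CodeFP (pairE (pairE kctxE (pairE unE (rawE L))) (pairE L L)) L (fun t => backSubK t.1.1 t.2.1 t.2.2) :=
    (backSubKC.comp ((fst _ _).fst'.pair (snd _ _)) :)
  have hv0 : CodeFP (pairE kctxE (pairE unE (rawE L))) L (fun s => (1 : ℕ) :: List.replicate (s.2.1 - s.2.2.length - 1) 0) :=
    ((rawCons natE).comp ((const _ (1 : ℕ)).pair ((replicateOf natE).comp ((const _ (0 : ℕ)).pair ((unSubLen unitE).comp
      (((unSubLen L).comp ((snd _ _).fst'.pair (snd _ _).snd')).pair (const _ [()])))))) :)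
  have hbwd := foldl (σ := (ℕ × ℕ × ℕ) × (ℕ × List (List ℕ))) (α := List ℕ) (β := List ℕ)
    (eσ := pairE kctxE (pairE unE (rawE L))) (eα := L)
    (eβ := L) (step := fun s piv v => backSubK s.1 piv v) (init := fun s => (1 : ℕ) :: List.replicate (s.2.1 - s.2.2.length - 1) 0)
    hbstep hv0 (20 * (X + 1) ^ 2) (fun s l₁ l₂ => by
      obtain ⟨c, n, pivs⟩ := s
      change (rawE natE (l₁.foldl (fun v piv => backSubK c piv v) ((1 : ℕ) :: List.replicate (n - pivs.length - 1) 0))).length ≤ _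
      set Lc := (pairE (pairE kctxE (pairE unE (rawE L))) (rawE L) ((c, n, pivs), l₁ ++ l₂)).length with hLc
      have hinv : ∀ u : List (List ℕ), KBnd c.1 (u.foldl (fun v piv => backSubK c piv v) ((1 : ℕ) :: List.replicate (n - pivs.length - 1) 0)) ∧
          (u.foldl (fun v piv => backSubK c piv v) ((1 : ℕ) :: List.replicate (n - pivs.length - 1) 0)).length = n - pivs.length - 1 + 1 + u.length := by
        intro u
        induction u using List.reverseRecOn with
        | nil =>
          refine ⟨fun x hx => ?_, by simp⟩
          rcases List.mem_cons.1 hx with rfl | hx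
          · exact Nat.one_le_two_pow
          · rw [List.eq_of_mem_replicate hx]; exact Nat.zero_le _
        | append_singleton u x ih =>
          rw [List.foldl_append, List.foldl_cons, List.foldl_nil, List.length_append, List.length_singleton]
          exact ⟨backSubK_bound c x ih.1, by rw [backSubK, List.length_cons, ih.2]; omega⟩
      obtain ⟨hbnd, hlen⟩ := hinv l₁
      obtain ⟨W, f, P⟩ := c
      have hLW : W ≤ Lc := by rw [hLc]; simp only [pairE_apply, length_boolPair, length_unE]; omega
      have hLn : n ≤ Lc := by rw [hLc]; simp only [pairE_apply, length_boolPair, length_unE]; omega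
      have hLu : l₁.length ≤ Lc := by
        rw [hLc]; simp only [pairE_apply, length_boolPair]
        have := length_le_length_rawE L (l₁ ++ l₂); rw [List.length_append] at this; omega
      have h1 := length_rawE_of_kbnd hbnd
      rw [hlen] at h1
      have h2 : (n - pivs.length - 1 + 1 + l₁.length) * (2 * W + 4) ≤ (2 * Lc + 1) * (2 * Lc + 4) :=
        Nat.mul_le_mul (by omega) (by omega)
      simp only [eval_mul, eval_pow, eval_add, eval_X, eval_ofNat, eval_one]
      nlinarith)
  have hsome : CodeFP (pairE kctxE (pairE unE (rawE L))) L (fun t =>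
      (kerFwdRunK t.1 t.2.1 (t.2.2, [], false)).2.1.foldl (fun v piv => backSubK t.1 piv v)
        ((1 : ℕ) :: List.replicate (t.2.1 - (kerFwdRunK t.1 t.2.1 (t.2.2, [], false)).2.1.length - 1) 0)) :=
    ((hbwd.comp ((((fst _ _).pair ((snd _ _).fst'.pair hst.snd'.fst')).pair hst.snd'.fst'))).congr fun _ => rfl)
  refine ((hst.snd'.snd'.ite ((optSome L).comp hsome) (const _ (none : Option (List ℕ)))).congr fun t => ?_)
  show (if (kerFwdRunK t.1 t.2.1 (t.2.2, [], false)).2.2 then _ else _) = kerVecK t.1 t.2.1 t.2.2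
  unfold kerVecK
  rfl

end Machine

end UmansFP

end Literature.Computability.Complexity

end
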